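import Summits.Ventures.PercRepro.Night4TrPackQ7Z064
import Summits.Ventures.PercRepro.Night4TrPackQ7Z065
import Summits.Ventures.PercRepro.Night4TrPackQ7Z066
import Summits.Ventures.PercRepro.Night4TrPackQ7Z067
import Summits.Ventures.PercRepro.Night4TrPackQ7Z068
import Summits.Ventures.PercRepro.Night4TrPackQ7Z069
import Summits.Ventures.PercRepro.Night4TrPackQ7Z070
import Summits.Ventures.PercRepro.Night4TrPackQ7Z071
import Summits.Ventures.PercRepro.Night4TrPackQ7Z072
import Summits.Ventures.PercRepro.Night4TrPackQ7Z073
import Summits.Ventures.PercRepro.Night4TrPackQ7Z074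
import Summits.Ventures.PercRepro.Night4TrPackQ7Z075
import Summits.Ventures.PercRepro.GenQTraceEightAll
import Summits.Ventures.PercRepro.GenQTraceSevenAll
import Summits.Ventures.PercRepro.GenQTraceTopColoop
import Summits.Ventures.PercRepro.GenQEightSixTrace
import Summits.Ventures.PercRepro.GenQTenEightGap

/-!
# PercRepro — the `(10, 8)` row: the trace residue at `t = 5` (night-4, gen 19 — modulo the gap)
`traceSeven_residue_of_hyps_t5_of_gap`: the `t = 5` block of `TraceSevenResidue` — the case split over the coloop count `m` and the corank `d` of the rank-`7` subset, one trace certificate `traceSum_nonneg_t5_c{d}_q7_m{m}` per certified case, the gap sub-instances (`traceGapSeven`) from `TraceSevenResidual`.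
-/
namespace PercRepro.Night4

open Finset ThmH SixFour GenQ PerFlat Star NightThree ThmN

variable {α : Type} [DecidableEq α] {M : Matroid α} [M.Finite]

/-- **The trace residue at `t = 5`** (the `t = 5` block of `TraceSevenResidue`): the rank-`7` subset `H` has `≤ m + fCore(7 − m)` points by its coloop count `m` (`card_le_mTr_add_of_flats`), `m ≥ 6` forces a basis (`card_eq_of_mTr_ge`); every `(d, m)` a certificate. -/
theorem traceSeven_residue_of_hyps_t5_of_gap (hres : TraceSevenResidual) (hs : Simple M) (hline : ∀ L ∈ flatsQ M 2, L.card ≤ 3) (hplane : ∀ P ∈ flatsQ M 3, P.card ≤ 6) (hsolid : ∀ F ∈ flatsQ M 4, F.card ≤ 10) (hflat5 : ∀ F ∈ flatsQ M 5, F.card ≤ 21) (hflat6 : ∀ F ∈ flatsQ M 6, F.card ≤ 43) (hflat7 : ∀ F ∈ flatsQ M 7, F.card ≤ 87) {H : Finset α} (hc : Core M 10) (hH : H ⊆ gr M) (hrH : M.eRk (H : Set α) = ((7 : ℕ) : ℕ∞)) (hlo : 7 + 5 ≤ H.card) (hhi : H.card < 38) : 0 ≤ ∑ B ∈ Rq M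 H 7, ((((7 + 1 : ℕ) : ℚ) + 2 - ((5 : ℕ) : ℚ)) * (1 / (2 + (mTr M B : ℚ))) - ((((7 + 1 : ℕ) : ℚ) + 2) / (((7 + 1 : ℕ) : ℚ) + 1)) * GenQ.dem M H 5 B) := by
  have hm7 : mTr M H ≤ 7 := mTr_le_of_eRk_eq hH hrH
  obtain ⟨d, hd⟩ : ∃ d, H.card = 7 + d := ⟨H.card - 7, by omega⟩
  obtain ⟨m, hm⟩ : ∃ m, mTr M H = m := ⟨_, rfl⟩
  have hm7' : m ≤ 7 := hm ▸ hm7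
  interval_cases m
  · -- m = 0
    have hsz : H.card ≤ 0 + 87 := card_le_mTr_add_of_flats (q := 7) (m := 0) hflat7 hH hrH hm
    have h1 : 5 ≤ d := by omega
    have h2 : d ≤ 30 := by omega
    interval_cases d
    · exact traceSum_nonneg_t5_c5_q7_m0 hs hline hplane hsolid hflat5 hflat6 hflat7 hH hrH hd hm
    · exact traceSum_nonneg_t5_c6_q7_m0 hs hline hplane hsolid hflat5 hflat6 hflat7 hH hrH hd hm
    · exact traceSum_nonneg_t5_c7_q7_m0 hs hline hplane hsolid hflat5 hflat6 hflat7 hH hrH hd hm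
    · exact traceSum_nonneg_t5_c8_q7_m0 hs hline hplane hsolid hflat5 hflat6 hflat7 hH hrH hd hm
    · exact hres M H hc hH hrH 5 9 0 (by decide) hd hm
    · exact hres M H hc hH hrH 5 10 0 (by decide) hd hm
    · exact hres M H hc hH hrH 5 11 0 (by decide) hd hm
    · exact hres M H hc hH hrH 5 12 0 (by decide) hd hm
    · exact hres M H hc hH hrH 5 13 0 (by decide) hd hm
    · exact hres M H hc hH hrH 5 14 0 (by decide) hd hm
    · exact traceSum_nonneg_t5_c15_q7_m0 hs hline hplane hsolid hflat5 hflat6 hflat7 hH hrH hd hm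
    · exact traceSum_nonneg_t5_c16_q7_m0 hs hline hplane hsolid hflat5 hflat6 hflat7 hH hrH hd hm
    · exact traceSum_nonneg_t5_c17_q7_m0 hs hline hplane hsolid hflat5 hflat6 hflat7 hH hrH hd hm
    · exact traceSum_nonneg_t5_c18_q7_m0 hs hline hplane hsolid hflat5 hflat6 hflat7 hH hrH hd hm
    · exact traceSum_nonneg_t5_c19_q7_m0 hs hline hplane hsolid hflat5 hflat6 hflat7 hH hrH hd hm
    · exact traceSum_nonneg_t5_c20_q7_m0 hs hline hplane hsolid hflat5 hflat6 hflat7 hH hrH hd hm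
    · exact traceSum_nonneg_t5_c21_q7_m0 hs hline hplane hsolid hflat5 hflat6 hflat7 hH hrH hd hm
    · exact traceSum_nonneg_t5_c22_q7_m0 hs hline hplane hsolid hflat5 hflat6 hflat7 hH hrH hd hm
    · exact traceSum_nonneg_t5_c23_q7_m0 hs hline hplane hsolid hflat5 hflat6 hflat7 hH hrH hd hm
    · exact traceSum_nonneg_t5_c24_q7_m0 hs hline hplane hsolid hflat5 hflat6 hflat7 hH hrH hd hm
    · exact traceSum_nonneg_t5_c25_q7_m0 hs hline hplane hsolid hflat5 hflat6 hflat7 hH hrH hd hm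
    · exact traceSum_nonneg_t5_c26_q7_m0 hs hline hplane hsolid hflat5 hflat6 hflat7 hH hrH hd hm
    · exact traceSum_nonneg_t5_c27_q7_m0 hs hline hplane hsolid hflat5 hflat6 hflat7 hH hrH hd hm
    · exact traceSum_nonneg_t5_c28_q7_m0 hs hline hplane hsolid hflat5 hflat6 hflat7 hH hrH hd hm
    · exact traceSum_nonneg_t5_c29_q7_m0 hs hline hplane hsolid hflat5 hflat6 hflat7 hH hrH hd hm
    · exact traceSum_nonneg_t5_c30_q7_m0 hs hline hplane hsolid hflat5 hflat6 hflat7 hH hrH hd hm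
  · -- m = 1
    have hsz : H.card ≤ 1 + 43 := card_le_mTr_add_of_flats (q := 7) (m := 1) hflat6 hH hrH hm
    have h1 : 5 ≤ d := by omega
    have h2 : d ≤ 30 := by omega
    interval_cases d
    · exact traceSum_nonneg_t5_c5_q7_m1 hs hline hplane hsolid hflat5 hflat6 hflat7 hH hrH hd hm
    · exact traceSum_nonneg_t5_c6_q7_m1 hs hline hplane hsolid hflat5 hflat6 hflat7 hH hrH hd hm
    · exact traceSum_nonneg_t5_c7_q7_m1 hs hline hplane hsolid hflat5 hflat6 hflat7 hH hrH hd hm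
    · exact traceSum_nonneg_t5_c8_q7_m1 hs hline hplane hsolid hflat5 hflat6 hflat7 hH hrH hd hm
    · exact hres M H hc hH hrH 5 9 1 (by decide) hd hm
    · exact hres M H hc hH hrH 5 10 1 (by decide) hd hm
    · exact hres M H hc hH hrH 5 11 1 (by decide) hd hm
    · exact hres M H hc hH hrH 5 12 1 (by decide) hd hm
    · exact hres M H hc hH hrH 5 13 1 (by decide) hd hm
    · exact hres M H hc hH hrH 5 14 1 (by decide) hd hm
    · exact hres M H hc hH hrH 5 15 1 (by decide) hd hm
    · exact traceSum_nonneg_t5_c16_q7_m1 hs hline hplane hsolid hflat5 hflat6 hflat7 hH hrH hd hm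
    · exact traceSum_nonneg_t5_c17_q7_m1 hs hline hplane hsolid hflat5 hflat6 hflat7 hH hrH hd hm
    · exact traceSum_nonneg_t5_c18_q7_m1 hs hline hplane hsolid hflat5 hflat6 hflat7 hH hrH hd hm
    · exact traceSum_nonneg_t5_c19_q7_m1 hs hline hplane hsolid hflat5 hflat6 hflat7 hH hrH hd hm
    · exact traceSum_nonneg_t5_c20_q7_m1 hs hline hplane hsolid hflat5 hflat6 hflat7 hH hrH hd hm
    · exact traceSum_nonneg_t5_c21_q7_m1 hs hline hplane hsolid hflat5 hflat6 hflat7 hH hrH hd hm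
    · exact traceSum_nonneg_t5_c22_q7_m1 hs hline hplane hsolid hflat5 hflat6 hflat7 hH hrH hd hm
    · exact traceSum_nonneg_t5_c23_q7_m1 hs hline hplane hsolid hflat5 hflat6 hflat7 hH hrH hd hm
    · exact traceSum_nonneg_t5_c24_q7_m1 hs hline hplane hsolid hflat5 hflat6 hflat7 hH hrH hd hm
    · exact traceSum_nonneg_t5_c25_q7_m1 hs hline hplane hsolid hflat5 hflat6 hflat7 hH hrH hd hm
    · exact traceSum_nonneg_t5_c26_q7_m1 hs hline hplane hsolid hflat5 hflat6 hflat7 hH hrH hd hm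
    · exact traceSum_nonneg_t5_c27_q7_m1 hs hline hplane hsolid hflat5 hflat6 hflat7 hH hrH hd hm
    · exact traceSum_nonneg_t5_c28_q7_m1 hs hline hplane hsolid hflat5 hflat6 hflat7 hH hrH hd hm
    · exact traceSum_nonneg_t5_c29_q7_m1 hs hline hplane hsolid hflat5 hflat6 hflat7 hH hrH hd hm
    · exact traceSum_nonneg_t5_c30_q7_m1 hs hline hplane hsolid hflat5 hflat6 hflat7 hH hrH hd hm
  · -- m = 2
    have hsz : H.card ≤ 2 + 21 := card_le_mTr_add_of_flats (q := 7) (m := 2) hflat5 hH hrH hm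
    have h1 : 5 ≤ d := by omega
    have h2 : d ≤ 16 := by omega
    interval_cases d
    · exact traceSum_nonneg_t5_c5_q7_m2 hs hline hplane hsolid hflat5 hflat6 hflat7 hH hrH hd hm
    · exact traceSum_nonneg_t5_c6_q7_m2 hs hline hplane hsolid hflat5 hflat6 hflat7 hH hrH hd hm
    · exact traceSum_nonneg_t5_c7_q7_m2 hs hline hplane hsolid hflat5 hflat6 hflat7 hH hrH hd hm
    · exact traceSum_nonneg_t5_c8_q7_m2 hs hline hplane hsolid hflat5 hflat6 hflat7 hH hrH hd hm
    · exact hres M H hc hH hrH 5 9 2 (by decide) hd hm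
    · exact hres M H hc hH hrH 5 10 2 (by decide) hd hm
    · exact hres M H hc hH hrH 5 11 2 (by decide) hd hm
    · exact hres M H hc hH hrH 5 12 2 (by decide) hd hm
    · exact hres M H hc hH hrH 5 13 2 (by decide) hd hm
    · exact hres M H hc hH hrH 5 14 2 (by decide) hd hm
    · exact hres M H hc hH hrH 5 15 2 (by decide) hd hm
    · exact hres M H hc hH hrH 5 16 2 (by decide) hd hm
  · -- m = 3
    have hsz : H.card ≤ 3 + 10 := card_le_mTr_add_of_flats (q := 7) (m := 3) hsolid hH hrH hm
    have h1 : 5 ≤ d := by omega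
    have h2 : d ≤ 6 := by omega
    interval_cases d
    · exact traceSum_nonneg_t5_c5_q7_m3 hs hline hplane hsolid hflat5 hflat6 hflat7 hH hrH hd hm
    · exact traceSum_nonneg_t5_c6_q7_m3 hs hline hplane hsolid hflat5 hflat6 hflat7 hH hrH hd hm
  · -- m = 4
    have hsz : H.card ≤ 4 + 6 := card_le_mTr_add_of_flats (q := 7) (m := 4) hplane hH hrH hm
    omega
  · -- m = 5
    have hsz : H.card ≤ 5 + 3 := card_le_mTr_add_of_flats (q := 7) (m := 5) hline hH hrH hm
    omega
  · -- m = 6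
    have h0 := card_eq_of_mTr_ge (q := 7) (H := H) hs hH hrH (by norm_num) hd (by omega)
    omega
  · -- m = 7
    have h0 := card_eq_of_mTr_ge (q := 7) (H := H) hs hH hrH (by norm_num) hd (by omega)
    omega

end PercRepro.Night4
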